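import Summits.CriticalPhenomena.PercolationContinuityZ3.Theorems.PercNearOneGluingAdditiveGluingMultiEdgeLemma3
import HarnessLib

/-! # Crux `PercNearOneGluing.AdditiveGluing` (stmt-CriticalPhenomena-4576) — the multi-edge Lemma 3 with a SINGLE witness
# (seat (b) V⁺-form, depth prover `png-dp-vplus`)

Support file (`--supports stmt-CriticalPhenomena-4576`); no definitions, no named facts.  Companion of
`…AdditiveGluingMultiEdgeLemma3.lean`.

`μ_w = prodBernoulli w` on the bond configurations of `Fin n`, target `b`, `τ(v) = μ_w(v ↔ b)`; `x` a vertex, `T ∌ x` a set of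
neighbours, `F = {s(x,a) : a ∈ T}`, `R = {some edge of F open}`, and `τ⁰(v)` the reliability under the weighting `pinW w F ∅`
(the edges of `F` removed).  The landed `multiEdge_lemma3` concludes `μ(R ∩ {d ↔ b}) ≤ μ(R ∩ {x ↔ b})` from `τ(d) ≤ τ(a)` for
EVERY `a ∈ T`.  Its proof uses the hypothesis only through one vertex, which gives the two theorems of this file:

* `multiEdge_lemma3_of_witness`: if `c` is `τ⁰`-minimal over `T` (`τ⁰(c) ≤ τ⁰(a)`, `a ∈ T`), `τ⁰(c) ≤ τ⁰(d)` and `τ(d) ≤ τ(c)`,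
  then `μ(R ∩ {d ↔ b}) ≤ μ(R ∩ {x ↔ b})`.  (For `c = d` the last two hypotheses are vacuous: a `τ⁰`-minimal vertex is beaten by
  `x` on `R` with no hypothesis in `w` at all.)
* `multiEdge_lemma3_singleWitness`: if `a⋆` is `τ⁰`-minimal over `T` (e.g. the least reliable neighbour of `x` in the graph
  WITHOUT the edges `x–T` — Kozma–Nitzan's Question-9 designation seen from `x`) and `τ(d) ≤ τ(a⋆)`, then
  `μ(R ∩ {d ↔ b}) ≤ μ(R ∩ {x ↔ b})`: ONE comparison, with the `τ⁰`-weakest neighbour, replaces the `|T|` comparisons of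
  `multiEdge_lemma3` (case split: if `τ⁰(d) ≤ τ⁰(a⋆)` take `c = d`, else `c = a⋆`).
This is the `|N| = 1` case ("U0, m = 1") of the single-witness form of the finger multi-edge Lemma 3 (registered open stub
`stub_fingerML3_vp`); the depth-prover numerics (exact enumeration, n ≤ 8) find the same single-witness implication with 0 failures for
every un-gluing of a glued finger block, which reduces that stub to independent finger blocks (memo in the seat NOTES).
[cite: KozmaNitzan2024, Lemma 3(i) (pp. 6–7), Lemma 5 (p. 13), Question 9 (p. 36)]
-/

namespace Summit.CriticalPhenomena.PercolationContinuityZ3.Theorems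

open MeasureTheory Set
open Literature.Probability.LatticeModels (prodBernoulli)
open Literature.Probability.Percolation (BondConfig openConn openGraph openEdgeCluster pinW localCylinder
  DeterminedBy determinedBy_iff)

noncomputable section
open Classical

section MultiEdgeSingleWitness

open Literature.Probability.LatticeModels Literature.Probability.Percolation

variable {n : ℕ}

/-- **Multi-edge Lemma 3 from one witness vertex.**  `x ∉ T`, `F = {s(x,a) : a ∈ T}`, `τ⁰` = reliability under `pinW w F ∅`
(edges of `F` removed).  If `τ⁰(c) ≤ τ⁰(a)` for all `a ∈ T`, `τ⁰(c) ≤ τ⁰(d)` and `τ(d) ≤ τ(c)`, then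
`μ(R ∩ {d ↔ b}) ≤ μ(R ∩ {x ↔ b})`, `R` = some edge `x–T` open.  Proof = the landed `multiEdge_lemma3` with its internal minimiser
replaced by the given witness `c`: pattern decomposition over `F`, `multiEdge_core` on every pattern meeting `R`
(`τ_J(c) ≤ τ_J(x)`), and `μ(R, d↔b) = τ(d) − μ[∅]τ⁰(d) ≤ τ(c) − μ[∅]τ⁰(c) = μ(R, c↔b)`.
[cite: KozmaNitzan2024, Lemma 3(i) (pp. 6–7), Lemma 5 (p. 13)] -/
theorem multiEdge_lemma3_of_witness (w : Sym2 (Fin n) → unitInterval) (x d c b : Fin n) (T : Finset (Fin n))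
    (hxT : x ∉ T)
    (hcT : ∀ a ∈ T,
      (prodBernoulli (pinW w (↑(T.image fun a => s(x, a)) : Set (Sym2 (Fin n))) ↑(∅ : Finset (Sym2 (Fin n))))).real
          (openConn c b) ≤
        (prodBernoulli (pinW w (↑(T.image fun a => s(x, a)) : Set (Sym2 (Fin n))) ↑(∅ : Finset (Sym2 (Fin n))))).real
          (openConn a b))
    (hcd : (prodBernoulli (pinW w (↑(T.image fun a => s(x, a)) : Set (Sym2 (Fin n))) ↑(∅ : Finset (Sym2 (Fin n))))).real
          (openConn c b) ≤
        (prodBernoulli (pinW w (↑(T.image fun a => s(x, a)) : Set (Sym2 (Fin n))) ↑(∅ : Finset (Sym2 (Fin n))))).real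
          (openConn d b))
    (hdc : (prodBernoulli w).real (openConn d b) ≤ (prodBernoulli w).real (openConn c b)) :
    (prodBernoulli w).real ({ω : Set (Sym2 (Fin n)) | ∃ a ∈ T, s(x, a) ∈ ω} ∩ openConn d b) ≤
      (prodBernoulli w).real ({ω : Set (Sym2 (Fin n)) | ∃ a ∈ T, s(x, a) ∈ ω} ∩ openConn x b) := by
  -- the star `F` and the event `R`
  set F : Finset (Sym2 (Fin n)) := T.image (fun a => s(x, a)) with hFdef
  have hF : ∀ e ∈ F, ∃ a, a ≠ x ∧ e = s(x, a) := by
    intro e he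
    obtain ⟨a, haT, rfl⟩ := Finset.mem_image.1 he
    exact ⟨a, fun h => hxT (h ▸ haT), rfl⟩
  have hR : {ω : Set (Sym2 (Fin n)) | ∃ a ∈ T, s(x, a) ∈ ω} = {ω | ∃ e ∈ F, e ∈ ω} := by
    ext ω
    simp only [Set.mem_setOf_eq, hFdef, Finset.mem_image]
    constructor
    · rintro ⟨a, haT, ha⟩; exact ⟨s(x, a), ⟨a, haT, rfl⟩, ha⟩
    · rintro ⟨e, ⟨a, haT, rfl⟩, he⟩; exact ⟨a, haT, he⟩
  rw [hR]
  set R : Set (Set (Sym2 (Fin n))) := {ω | ∃ e ∈ F, e ∈ ω} with hRdef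
  -- base weighting `w⁰` (star removed) and its reliabilities
  set w₀ : Sym2 (Fin n) → unitInterval := pinW w ↑F ↑(∅ : Finset (Sym2 (Fin n))) with hw₀
  set τ₀ : Fin n → ℝ := fun v => (prodBernoulli w₀).real (openConn v b) with hτ₀
  have hcT' : ∀ a ∈ T, τ₀ c ≤ τ₀ a := fun a ha => hcT a ha
  have hcd' : τ₀ c ≤ τ₀ d := hcd
  -- (i) CORE on every pattern meeting `R`
  have hcore : ∀ J : Finset (Sym2 (Fin n)), J ⊆ F → (↑J : Set (Sym2 (Fin n))) ∈ R →
      (prodBernoulli (pinW w ↑F ↑J)).real (openConn c b) ≤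
        (prodBernoulli (pinW w ↑F ↑J)).real (openConn x b) := by
    intro J hJF hJR
    obtain ⟨e, heF, heJ⟩ := hJR
    have heJ' : e ∈ J := Finset.mem_coe.1 heJ
    obtain ⟨a, hax, rfl⟩ := hF e heF
    have haT : a ∈ T := by
      obtain ⟨a', ha'T, he'⟩ := Finset.mem_image.1 heF
      rcases Sym2.eq_iff.1 he' with ⟨-, h⟩ | ⟨h, -⟩
      · exact h ▸ ha'T
      · exact (hax h.symm).elim
    exact multiEdge_core w hF hJF heJ' hax c b (hcT' a haT)
  -- law of total probability over the patterns of `F`, for `R` and for `Rᶜ`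
  have hRm : MeasurableSet R := MeasurableSet.of_discrete
  have hdec := fun v : Fin n =>
    prodBernoulli_real_inter_eq_sum_pinW w F (A := openConn v b) (B := R) MeasurableSet.of_discrete
      (DepthOneGluing.determinedBy_exists_mem F)
  have hdecC := fun v : Fin n =>
    prodBernoulli_real_inter_eq_sum_pinW w F (A := openConn v b) (B := Rᶜ) MeasurableSet.of_discrete
      (determinedBy_forall_not_mem F)
  have hN : ∀ v : Fin n, (prodBernoulli w).real (openConn v b ∩ Rᶜ) =
      (prodBernoulli w).real (localCylinder ↑F ↑(∅ : Finset (Sym2 (Fin n)))) * τ₀ v := by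
    intro v
    rw [hdecC v]
    refine Finset.sum_eq_single_of_mem ∅ ?_ ?_
    · refine (@Finset.mem_filter _ _ (_) _ _).2 ⟨Finset.mem_powerset.2 (Finset.empty_subset F), ?_⟩
      rintro ⟨e, -, he⟩
      exact Finset.notMem_empty e (Finset.mem_coe.1 he)
    · intro J hJ hne
      exfalso
      obtain ⟨hJF, hno⟩ := (@Finset.mem_filter _ _ (_) _ _).1 hJ
      obtain ⟨e, heJ⟩ := Finset.nonempty_iff_ne_empty.2 hne
      exact hno ⟨e, Finset.mem_powerset.1 hJF heJ, Finset.mem_coe.2 heJ⟩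
  have hsplit : ∀ v : Fin n, (prodBernoulli w).real (openConn v b ∩ R) +
      (prodBernoulli w).real (openConn v b ∩ Rᶜ) = (prodBernoulli w).real (openConn v b) :=
    fun v => measureReal_inter_add_sdiff (μ := prodBernoulli w) (s := openConn v b) hRm
  -- (ii) `μ(c↔b, R) ≤ μ(x↔b, R)` termwise
  have hcx : (prodBernoulli w).real (openConn c b ∩ R) ≤ (prodBernoulli w).real (openConn x b ∩ R) := by
    rw [hdec c, hdec x]
    refine Finset.sum_le_sum fun J hJ => mul_le_mul_of_nonneg_left ?_ measureReal_nonneg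
    obtain ⟨hJF, hJR⟩ := (@Finset.mem_filter _ _ (_) _ _).1 hJ
    exact hcore J (Finset.mem_powerset.1 hJF) hJR
  -- (iii) `μ(d↔b, R) ≤ μ(c↔b, R)` from `τ(d) ≤ τ(c)` and `τ⁰(c) ≤ τ⁰(d)`
  have hdc' : (prodBernoulli w).real (openConn d b ∩ R) ≤ (prodBernoulli w).real (openConn c b ∩ R) := by
    have hd := hsplit d
    have hc' := hsplit c
    rw [hN] at hd hc'
    have hmono : (prodBernoulli w).real (localCylinder ↑F ↑(∅ : Finset (Sym2 (Fin n)))) * τ₀ c ≤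
        (prodBernoulli w).real (localCylinder ↑F ↑(∅ : Finset (Sym2 (Fin n)))) * τ₀ d :=
      mul_le_mul_of_nonneg_left hcd' measureReal_nonneg
    linarith
  rw [Set.inter_comm R (openConn d b), Set.inter_comm R (openConn x b)]
  exact hdc'.trans hcx

/-- **Multi-edge Lemma 3 with a SINGLE witness** (Question-9 form).  `x ∉ T`, `F = {s(x,a) : a ∈ T}`, `τ⁰` = reliability under
`pinW w F ∅`.  If `a⋆` satisfies `τ⁰(a⋆) ≤ τ⁰(a)` for all `a ∈ T` (e.g. `a⋆` = the `τ⁰`-least neighbour of `x`) and `τ(d) ≤ τ(a⋆)`,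
then `μ(R ∩ {d ↔ b}) ≤ μ(R ∩ {x ↔ b})`, `R` = some edge `x–T` open.  (`multiEdge_lemma3` needs `τ(d) ≤ τ(a)` for every `a ∈ T`.)
Proof: `multiEdge_lemma3_of_witness` with `c = d` if `τ⁰(d) ≤ τ⁰(a⋆)`, else `c = a⋆`.
[cite: KozmaNitzan2024, Lemma 3(i) (pp. 6–7), Lemma 5 (p. 13), Question 9 (p. 36)] -/
theorem multiEdge_lemma3_singleWitness (w : Sym2 (Fin n) → unitInterval) (x d astar b : Fin n) (T : Finset (Fin n))
    (hxT : x ∉ T)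
    (hstar : ∀ a ∈ T,
      (prodBernoulli (pinW w (↑(T.image fun a => s(x, a)) : Set (Sym2 (Fin n))) ↑(∅ : Finset (Sym2 (Fin n))))).real
          (openConn astar b) ≤
        (prodBernoulli (pinW w (↑(T.image fun a => s(x, a)) : Set (Sym2 (Fin n))) ↑(∅ : Finset (Sym2 (Fin n))))).real
          (openConn a b))
    (hle : (prodBernoulli w).real (openConn d b) ≤ (prodBernoulli w).real (openConn astar b)) :
    (prodBernoulli w).real ({ω : Set (Sym2 (Fin n)) | ∃ a ∈ T, s(x, a) ∈ ω} ∩ openConn d b) ≤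
      (prodBernoulli w).real ({ω : Set (Sym2 (Fin n)) | ∃ a ∈ T, s(x, a) ∈ ω} ∩ openConn x b) := by
  by_cases hcase :
      (prodBernoulli (pinW w (↑(T.image fun a => s(x, a)) : Set (Sym2 (Fin n))) ↑(∅ : Finset (Sym2 (Fin n))))).real
          (openConn d b) ≤
        (prodBernoulli (pinW w (↑(T.image fun a => s(x, a)) : Set (Sym2 (Fin n))) ↑(∅ : Finset (Sym2 (Fin n))))).real
          (openConn astar b)
  · -- `d` itself is `τ⁰`-minimal over `T`: witness `c = d`, no hypothesis in `w` needed
    exact multiEdge_lemma3_of_witness w x d d b T hxT (fun a ha => hcase.trans (hstar a ha)) le_rfl le_rfl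
  · -- witness `c = a⋆`
    exact multiEdge_lemma3_of_witness w x d astar b T hxT hstar (le_of_lt (not_le.1 hcase)) hle


/-- Registered rung `stub_multiEdgeSingleWitness_vp` of crux stmt-CriticalPhenomena-4576 (depth prover png-dp-vplus, seat (b) V⁺-form): the multi-edge Lemma 3 with a single witness — `multiEdge_lemma3_singleWitness`, closed statement. [cite: KozmaNitzan2024, Lemma 3(i) (pp. 6–7), Lemma 5 (p. 13)] -/
theorem stub_multiEdgeSingleWitness_vp : ∀ (n : ℕ) (w : Sym2 (Fin n) → unitInterval) (T : Finset (Fin n)) (x d astar b : Fin n), x ∉ T → (∀ a ∈ T, (Literature.Probability.LatticeModels.prodBernoulli (Literature.Probability.Percolation.pinW w (↑(T.image fun a => s(x, a)) : Set (Sym2 (Fin n))) ↑(∅ : Finset (Sym2 (Fin n))))).real (Literature.Probability.Percolation.openConn astar b) ≤ (Literature.Probability.LatticeModels.prodBernoulli (Literature.Probability.Percolation.pinW w (↑(T.image fun a => s(x, a)) : Set (Sym2 (Fin n))) ↑(∅ : Finset (Sym2 (Fin n))))).real (Literature.Probability.Percolation.openConn a b)) → (Literature.Probability.LatticeModels.prodBernoulli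 w).real (Literature.Probability.Percolation.openConn d b) ≤ (Literature.Probability.LatticeModels.prodBernoulli w).real (Literature.Probability.Percolation.openConn astar b) → (Literature.Probability.LatticeModels.prodBernoulli w).real ({ω : Set (Sym2 (Fin n)) | ∃ a ∈ T, s(x, a) ∈ ω} ∩ Literature.Probability.Percolation.openConn d b) ≤ (Literature.Probability.LatticeModels.prodBernoulli w).real ({ω : Set (Sym2 (Fin n)) | ∃ a ∈ T, s(x, a) ∈ ω} ∩ Literature.Probability.Percolation.openConn x b) :=
  fun _ w T x d astar b hxT hstar hle => multiEdge_lemma3_singleWitness w x d astar b T hxT hstar hle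

end MultiEdgeSingleWitness

end

end Summit.CriticalPhenomena.PercolationContinuityZ3.Theorems
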